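import Summits.HodgeConjecture.CorCM.MumfordTateRankSixNondegenerate
import Summits.HodgeConjecture.CorCM.MumfordTateRankLeFourHodge
import HarnessLib

/-!
# Hodge groups of semisimple rank one with centre of dimension `3`: the rung `dim MT(H¹(X)) = 7`, `Hg = SL₂ · T³`,
# reduced to Markman's fourfold theorem

COR-CM (cell `pub-hodgecm2`, seat `b27` gen 38, count-neutral lane MT-RANK-SIX-CMPART; theorems only, no definition,
no named fact).  HC_CM is NOT proved and NOT used.  The only non-trivial input beyond the tree's theorems is the NAMED FACT
`Markman2025_weilClasses_algebraic_abelianFourfold` (Weil classes on abelian fourfolds are algebraic), taken as an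
explicit hypothesis exactly as in `CorCM/MumfordTateRankLeFourHodge` (gen 32); the unconditional statements do not use it.

By `CorCM/MumfordTateRankSixCMRank` a complex abelian variety `X` with `0 < dim X` and
`dim [Lie Hg(H¹X), Lie Hg(H¹X)] = 3` is isogenous to `B^{m+1} × Z` with `Lie Hg(H¹B) = 𝔰𝔩₂` and `Z` of CM type with
`dim MT(H¹Z) = dim MT(H¹X) − 3`.  For `dim MT(H¹X) ≤ 7` the CM part has `dim MT(H¹Z) ≤ 4`, the range of gen 32's trichotomy
(`forall_powSucc_or_shape_of_mtRank_hodge_one_le_four`: all powers divisor-generated, or one of the two Weil-type shapes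
`A^{m+1}`, `E^c × T^a`) and of `hodgeConjectureFor_powSucc_of_isOfCMType_of_mtRank_hodge_one_le_four_of_markman`:

* **`isStablyNondegenerate_or_cmPart_degenerate_of_finrank_derived_eq_three_of_mtRank_le_seven`** — UNCONDITIONAL
  dichotomy: `X` is stably nondegenerate (`B = D` on all powers, HC for all powers), OR `dim MT(H¹X) = 7` and the CM part
  `Z` has `dim MT(H¹Z) = 4` with some power NOT divisor-generated (Weil-type degenerate CM part).
* **`hodgeConjectureFor_powSucc_of_finrank_derived_eq_three_of_mtRank_le_seven_of_markman`** — given Markman's theorem,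
  the Hodge conjecture for ALL powers of every `X` with `dim [Lie Hg, Lie Hg] = 3` and `dim MT(H¹X) ≤ 7`
  (`Hg = SL₂ · T^{≤3}`), their isogeny classes and everything they dominate.
* **`hodgeConjectureFor_powSucc_of_not_isOfCMType_of_mtRank_le_seven_of_center_ne_bot_of_markman`** — for `X` NOT of
  CM type with `dim MT(H¹X) ≤ 7` the only case NOT covered is `dim MT = 7` with SEMISIMPLE Hodge Lie algebra of dimension
  `6` (`center_derived_of_mtRank_hodge_one_eq_seven`: `(dim 𝔷, dim 𝔡) = (3,3)` or `(0,6)`); so HC holds (given Markman)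
  for all powers of every non-CM `X` with `dim MT(H¹X) ≤ 7` whose Hodge Lie algebra has NON-ZERO centre.

## References

* [MoonenZarhin1999LowDim] B. Moonen, Yu. Zarhin, *Hodge classes on abelian varieties of low dimension*, Math. Ann.
  315 (1999), §2 (2.1)–(2.5), §3 Thm. (3.2)(2), Thms. (0.1)–(0.2).
* [Markman2025SurveySecant] E. Markman, *Secant sheaves and Weil classes on abelian varieties*, arXiv:2509.23403,
  Thm. 1.2 (Weil classes on abelian fourfolds are algebraic).
* [Gordon1999HodgeAVSurvey] B. B. Gordon, *A survey of the Hodge conjecture for abelian varieties* (1999), §7.3.2, 7.5,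
  10.10.
* [vanGeemen1994HodgeAV] B. van Geemen, *An introduction to the Hodge conjecture for abelian varieties* (1994), §2.4–2.5,
  §3.6–3.7.
* [MumfordAV1970] D. Mumford, *Abelian Varieties* (1970), §19 Thm. 1 and p. 169.
-/

noncomputable section

open CategoryTheory CategoryTheory.Limits Module

namespace Summit.HodgeConjecture.CorCM

open Literature.AlgebraicGeometry.Motives
open Literature.AlgebraicGeometry.Motives.AbelianVariety
open Literature.AlgebraicGeometry.Motives.HodgeStructure
open Literature.AlgebraicGeometry.HodgeTheory
open Literature.AlgebraicGeometry.Milne1999 (IsOfCMType)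
open Summit.HodgeConjecture.CorCM.Domination

variable [HodgeTensorFacts.{0, 0}] {X : AbelianVariety ℂ} {n : ℕ}

/-! ## §1 The unconditional dichotomy -/

/-- **Semisimple rank one, `dim MT(H¹X) ≤ 7`: `X` is stably nondegenerate unless the CM part is Weil-type degenerate.**
For a complex abelian variety `X` with `0 < dim X`, `dim [Lie Hg(H¹X), Lie Hg(H¹X)] = 3` and `dim MT(H¹X) ≤ 7`: EITHER
every power `X^{N+1}` is divisor-generated (`B = D`; then HC holds for all powers), OR `dim MT(H¹X) = 7` and `X ∼ B^{m+1} × Z`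
with `B` SIMPLE non-CM (`0 < dim B ≤ 2`, `dim End⁰B = (dim B)²`), `Z` of CM type with `dim MT(H¹Z) = 4` and some power
`Z^{N+1}` NOT divisor-generated (by gen 32, `Z` is then isogenous to a power of a simple CM fourfold of Weil type or to
`E^c × T^a` with `k_E ↪ K_T`).  UNCONDITIONAL. [cite: MoonenZarhin1999LowDim, §2 (2.1)–(2.5) and §3 Thm. (3.2)(2)]
[cite: Gordon1999HodgeAVSurvey, Thm. 7.5, Def. 7.6 and §7.3.2] -/
theorem isStablyNondegenerate_or_cmPart_degenerate_of_finrank_derived_eq_three_of_mtRank_le_seven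
    (hX : IsSmoothProjective n X.X) (h0 : 0 < X.dim)
    (h3 : haveI := BettiUniverse.finite hX 1
      Module.finrank ℚ ↥(Submodule.span ℚ {B | ∃ X' ∈ (BettiUniverse.hodge exists_isReal_hodgeModel_holds hX 1).hodgeLie,
        ∃ Y ∈ (BettiUniverse.hodge exists_isReal_hodgeModel_holds hX 1).hodgeLie, X' * Y - Y * X' = B}) = 3)
    (h7 : haveI := BettiUniverse.finite hX 1
      (BettiUniverse.hodge exists_isReal_hodgeModel_holds hX 1).mtRank ≤ 7) :
    haveI := BettiUniverse.finite hX 1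
    IsStablyNondegenerate X ∨
      ((BettiUniverse.hodge exists_isReal_hodgeModel_holds hX 1).mtRank = 7 ∧
        ∃ (B Z : AbelianVariety ℂ) (m : ℕ), B.IsSimple ∧ 0 < B.dim ∧ B.dim ≤ 2 ∧ ¬ IsOfCMType B ∧
          Module.finrank ℚ B.endAlgebra = B.dim ^ 2 ∧ IsOfCMType Z ∧ IsIsogenous X ((B.powSucc m).prod Z) ∧
          (m + 1) * B.dim + Z.dim = X.dim ∧ 0 < Z.dim ∧
          (haveI := BettiUniverse.finite (AbelianVariety.isSmoothProjective_holds (A := Z)) 1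
          (BettiUniverse.hodge exists_isReal_hodgeModel_holds (AbelianVariety.isSmoothProjective_holds (A := Z)) 1).mtRank = 4) ∧
          ¬ ∀ N : ℕ, IsDivisorGenerated (Z.powSucc N)) := by
  haveI := BettiUniverse.finite hX 1
  obtain ⟨B, Z, m, hBs, hB0, hB2, hBcm, hfinB, -, hZcm, hXYZ, hdims, hZ0, -, hLie, hmt⟩ :=
    exists_isIsogenous_powSucc_prod_finrank_hodgeLie_of_finrank_derived_eq_three hX h0 h3
  obtain ⟨hne, h3B⟩ := not_le_endAlg_and_finrank_hodgeLie_le_three_of_factor hBs hB0 hBcm hfinB hB2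
  -- if every power of the CM part is divisor-generated, `X` is stably nondegenerate
  by_cases hZD : ∀ N : ℕ, IsDivisorGenerated (Z.powSucc N)
  · left
    have hBZ : IsStablyNondegenerate (B.prod Z) :=
      isStablyNondegenerate_prod_of_finrank_hodgeLie_le_three_of_isOfCMType hne h3B hZcm hZD
    have hXYZ' : IsIsogenous X ((B.powSucc m).prod (Z.powSucc 0)) := by rw [AbelianVariety.powSucc_zero]; exact hXYZ
    exact (hBZ.powSucc_prod_powSucc m 0).of_isIsogenous hXYZ'
  · right
    -- then `dim Z > 0` (powers of the zero abelian variety are divisor-generated) and `dim MT(H¹Z) = 4`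
    have hZpos : 0 < Z.dim := by
      rcases Nat.eq_zero_or_pos Z.dim with h | h
      · exact absurd (fun N => isDivisorGenerated_powSucc_of_isOfCMType_of_dim_le_three hZcm (by omega) N) hZD
      · exact h
    have hZsp : IsSmoothProjective Z.dim Z.X := AbelianVariety.isSmoothProjective_holds
    have hmtZ := hmt hZpos
    have hZ4 : haveI := BettiUniverse.finite hZsp 1
        (BettiUniverse.hodge exists_isReal_hodgeModel_holds hZsp 1).mtRank = 4 := by
      by_contra hne4
      have hZ3 : haveI := BettiUniverse.finite hZsp 1
          (BettiUniverse.hodge exists_isReal_hodgeModel_holds hZsp 1).mtRank ≤ 3 := by omega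
      exact hZD fun N => isDivisorGenerated_powSucc_of_mtRank_hodge_one_le_three hZsp hZpos hZ3 N
    exact ⟨by omega, B, Z, m, hBs, hB0, hB2, hBcm, hfinB, hZcm, hXYZ, hdims, hZpos, hZ4, hZD⟩

/-! ## §2 The Hodge conjecture for all powers, given Markman's fourfold theorem -/

omit [HodgeTensorFacts.{0, 0}] in
/-- **`X^{N+1} ≼ B^{K+1} × Z^{K+1}` for the splitting of `CorCM/MumfordTateRankSixCMRank`** (domination bookkeeping as in
`CorCM/MumfordTateRankSixHodge`, here for the SAME `Z` whose Mumford–Tate rank is known). [cite: MumfordAV1970, §19 Thm. 1 and p. 169] -/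
private theorem avDominatedBy_powSucc_of_isIsogenous_powSucc_prod {B Z : AbelianVariety ℂ} {m : ℕ}
    (hXYZ : IsIsogenous X ((B.powSucc m).prod Z)) (N : ℕ) :
    AVDominatedBy (X.powSucc N) ((B.powSucc (m + N * (m + 1))).prod (Z.powSucc (m + N * (m + 1)))) := by
  have hdom : AVDominatedBy X ((B.powSucc m).prod (Z.powSucc m)) :=
    (AVDominatedBy.of_isIsogenous hXYZ (AVDominatedBy.refl _)).trans
      ((AVDominatedBy.refl _).prod (avDominatedBy_powSucc_of_le Z (Nat.zero_le m)))
  exact (avDominatedBy_powSucc_of_avDominatedBy hdom N).trans ((avDominatedBy_powSucc_prod _ _ N).trans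
    ((avDominatedBy_powSucc_powSucc B m N).prod (avDominatedBy_powSucc_powSucc Z m N)))

/-- **Given Markman's fourfold theorem: the Hodge conjecture for ALL powers of every complex abelian variety `X` whose
Hodge group has semisimple rank one (`dim [Lie Hg(H¹X), Lie Hg(H¹X)] = 3`) and `dim MT(H¹(X)) ≤ 7`** (`Hg = SL₂ · T^{≤ 3}`).
The CM part `Z` of `X ∼ B^{m+1} × Z` has `dim MT(H¹Z) ≤ 4`, so every power of `Z` satisfies HC given Markman (gen 32,
`hodgeConjectureFor_powSucc_of_isOfCMType_of_mtRank_hodge_one_le_four_of_markman`); the `𝔰𝔩₂`-isotypic product theorem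
transfers this to `B^{K+1} × Z^{K+1} ≽ X^{N+1}`.  HC_CM is NOT asserted; Markman's theorem is the displayed hypothesis.
[cite: Markman2025SurveySecant, Thm. 1.2] [cite: MoonenZarhin1999LowDim, §3 Thm. (3.2)(2) and Thms. (0.1)–(0.2)]
[cite: Gordon1999HodgeAVSurvey, §7.3.2 and 10.10] -/
theorem hodgeConjectureFor_powSucc_of_finrank_derived_eq_three_of_mtRank_le_seven_of_markman
    (hX : IsSmoothProjective n X.X) (hW4 : Markman2025_weilClasses_algebraic_abelianFourfold) (h0 : 0 < X.dim)
    (h3 : haveI := BettiUniverse.finite hX 1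
      Module.finrank ℚ ↥(Submodule.span ℚ {B | ∃ X' ∈ (BettiUniverse.hodge exists_isReal_hodgeModel_holds hX 1).hodgeLie,
        ∃ Y ∈ (BettiUniverse.hodge exists_isReal_hodgeModel_holds hX 1).hodgeLie, X' * Y - Y * X' = B}) = 3)
    (h7 : haveI := BettiUniverse.finite hX 1
      (BettiUniverse.hodge exists_isReal_hodgeModel_holds hX 1).mtRank ≤ 7) (N : ℕ) :
    HodgeConjectureFor (X.powSucc N).dim (X.powSucc N).X := by
  haveI := BettiUniverse.finite hX 1
  obtain ⟨B, Z, m, hBs, hB0, hB2, hBcm, hfinB, -, hZcm, hXYZ, -, -, -, hLie, hmt⟩ :=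
    exists_isIsogenous_powSucc_prod_finrank_hodgeLie_of_finrank_derived_eq_three hX h0 h3
  obtain ⟨hne, h3B⟩ := not_le_endAlg_and_finrank_hodgeLie_le_three_of_factor hBs hB0 hBcm hfinB hB2
  -- HC for every power of the CM part (Markman at Mumford–Tate rank `4`, `B = D` below)
  have hZHC : ∀ K : ℕ, HodgeConjectureFor (Z.powSucc K).dim (Z.powSucc K).X := by
    intro K
    rcases Nat.eq_zero_or_pos Z.dim with hZ0 | hZpos
    · exact hodgeConjectureFor_powSucc_of_isOfCMType_of_dim_le_three hZcm (by omega) K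
    · have hZsp : IsSmoothProjective Z.dim Z.X := AbelianVariety.isSmoothProjective_holds
      have hmtZ := hmt hZpos
      exact hodgeConjectureFor_powSucc_of_isOfCMType_of_mtRank_hodge_one_le_four_of_markman hZsp hW4 hZpos hZcm
        (by omega) K
  exact hodgeConjectureFor_of_avDominatedBy
    (hodgeConjectureFor_powSucc_prod_powSucc_of_finrank_hodgeLie_le_three_of_isOfCMType hne h3B hZcm _ (hZHC _))
    (avDominatedBy_powSucc_of_isIsogenous_powSucc_prod hXYZ N)

/-- **… for `X` itself** (`N = 0`). [cite: Markman2025SurveySecant, Thm. 1.2] [cite: MoonenZarhin1999LowDim, Thms. (0.1)–(0.2)] -/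
theorem hodgeConjectureFor_of_finrank_derived_eq_three_of_mtRank_le_seven_of_markman
    (hX : IsSmoothProjective n X.X) (hW4 : Markman2025_weilClasses_algebraic_abelianFourfold) (h0 : 0 < X.dim)
    (h3 : haveI := BettiUniverse.finite hX 1
      Module.finrank ℚ ↥(Submodule.span ℚ {B | ∃ X' ∈ (BettiUniverse.hodge exists_isReal_hodgeModel_holds hX 1).hodgeLie,
        ∃ Y ∈ (BettiUniverse.hodge exists_isReal_hodgeModel_holds hX 1).hodgeLie, X' * Y - Y * X' = B}) = 3)
    (h7 : haveI := BettiUniverse.finite hX 1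
      (BettiUniverse.hodge exists_isReal_hodgeModel_holds hX 1).mtRank ≤ 7) :
    HodgeConjectureFor X.dim X.X :=
  hodgeConjectureFor_powSucc_of_finrank_derived_eq_three_of_mtRank_le_seven_of_markman hX hW4 h0 h3 h7 0

/-- **… and for everything dominated by a power** (abelian subvarieties, quotients, isogeny classes of the `X^{N+1}`).
[cite: vanGeemen1994HodgeAV, §2.4–2.5 and §3.6–3.7] [cite: Markman2025SurveySecant, Thm. 1.2] -/
theorem hodgeConjectureFor_of_avDominatedBy_powSucc_of_finrank_derived_eq_three_of_mtRank_le_seven_of_markman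
    (hX : IsSmoothProjective n X.X) (hW4 : Markman2025_weilClasses_algebraic_abelianFourfold) (h0 : 0 < X.dim)
    (h3 : haveI := BettiUniverse.finite hX 1
      Module.finrank ℚ ↥(Submodule.span ℚ {B | ∃ X' ∈ (BettiUniverse.hodge exists_isReal_hodgeModel_holds hX 1).hodgeLie,
        ∃ Y ∈ (BettiUniverse.hodge exists_isReal_hodgeModel_holds hX 1).hodgeLie, X' * Y - Y * X' = B}) = 3)
    (h7 : haveI := BettiUniverse.finite hX 1
      (BettiUniverse.hodge exists_isReal_hodgeModel_holds hX 1).mtRank ≤ 7)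
    {Y : AbelianVariety ℂ} {N : ℕ} (hY : AVDominatedBy Y (X.powSucc N)) : HodgeConjectureFor Y.dim Y.X :=
  hodgeConjectureFor_of_avDominatedBy
    (hodgeConjectureFor_powSucc_of_finrank_derived_eq_three_of_mtRank_le_seven_of_markman hX hW4 h0 h3 h7 N) hY

/-! ## §3 Mumford–Tate rank `≤ 7`, `X` not of CM type, Hodge Lie algebra with non-zero centre -/

/-- **For `X` NOT of CM type with `dim MT(H¹X) ≤ 7` and Hodge Lie algebra with NON-ZERO CENTRE, the derived algebra is
three-dimensional** — the shape table of `CorCM/MumfordTateRankSix`: `t = 4, 5, 6 ⟹ dim 𝔡 = 3`; `t = 7 ⟹ (dim 𝔷, dim 𝔡) =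
(3,3)` or `(0,6)`, and the second is excluded by `𝔷 ≠ 0`. [cite: MoonenZarhin1999LowDim, §2] -/
theorem finrank_derived_eq_three_of_mtRank_le_seven_of_center_ne_bot (hX : IsSmoothProjective n X.X) (h0 : 0 < X.dim)
    (hcm : ¬ IsOfCMType X)
    (h7 : haveI := BettiUniverse.finite hX 1
      (BettiUniverse.hodge exists_isReal_hodgeModel_holds hX 1).mtRank ≤ 7)
    (hz : haveI := BettiUniverse.finite hX 1
      (BettiUniverse.hodge exists_isReal_hodgeModel_holds hX 1).hodgeLie ⊓
        Subalgebra.toSubmodule (BettiUniverse.hodge exists_isReal_hodgeModel_holds hX 1).endAlg ≠ ⊥) :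
    haveI := BettiUniverse.finite hX 1
    Module.finrank ℚ ↥(Submodule.span ℚ {B | ∃ X' ∈ (BettiUniverse.hodge exists_isReal_hodgeModel_holds hX 1).hodgeLie,
      ∃ Y ∈ (BettiUniverse.hodge exists_isReal_hodgeModel_holds hX 1).hodgeLie, X' * Y - Y * X' = B}) = 3 := by
  haveI := BettiUniverse.finite hX 1
  have hz' : Module.finrank ℚ ↥((BettiUniverse.hodge exists_isReal_hodgeModel_holds hX 1).hodgeLie ⊓
      Subalgebra.toSubmodule (BettiUniverse.hodge exists_isReal_hodgeModel_holds hX 1).endAlg) ≠ 0 := fun h =>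
    hz (Submodule.finrank_eq_zero.1 h)
  obtain ⟨h1, h3, h4, h5, -⟩ := mtRank_hodge_one_shape hX h0 hcm
  omega

/-- **Given Markman's fourfold theorem: the Hodge conjecture for all powers of every complex abelian variety `X` NOT of CM
type with `dim MT(H¹(X)) ≤ 7` whose Hodge Lie algebra has NON-ZERO centre** (the remaining case at rank `7` is a
SEMISIMPLE six-dimensional Hodge Lie algebra — two `𝔰𝔩₂`-factors — outside the semisimple-rank-one analysis).  For
`dim MT ≤ 6` this is unconditional and centre-free (`CorCM/MumfordTateRankSixNondegenerate`); new is `dim MT = 7`,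
`Hg = SL₂ · T³`. [cite: Markman2025SurveySecant, Thm. 1.2] [cite: MoonenZarhin1999LowDim, §2 and Thms. (0.1)–(0.2)]
[cite: Gordon1999HodgeAVSurvey, §7.3.2 and 10.10] -/
theorem hodgeConjectureFor_powSucc_of_not_isOfCMType_of_mtRank_le_seven_of_center_ne_bot_of_markman
    (hX : IsSmoothProjective n X.X) (hW4 : Markman2025_weilClasses_algebraic_abelianFourfold) (h0 : 0 < X.dim)
    (hcm : ¬ IsOfCMType X)
    (h7 : haveI := BettiUniverse.finite hX 1
      (BettiUniverse.hodge exists_isReal_hodgeModel_holds hX 1).mtRank ≤ 7)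
    (hz : haveI := BettiUniverse.finite hX 1
      (BettiUniverse.hodge exists_isReal_hodgeModel_holds hX 1).hodgeLie ⊓
        Subalgebra.toSubmodule (BettiUniverse.hodge exists_isReal_hodgeModel_holds hX 1).endAlg ≠ ⊥) (N : ℕ) :
    HodgeConjectureFor (X.powSucc N).dim (X.powSucc N).X :=
  hodgeConjectureFor_powSucc_of_finrank_derived_eq_three_of_mtRank_le_seven_of_markman hX hW4 h0
    (finrank_derived_eq_three_of_mtRank_le_seven_of_center_ne_bot hX h0 hcm h7 hz) h7 N

/-- **Unconditional version of §3 below rank `7`**, recorded for contrast: for `X` NOT of CM type with `dim MT(H¹X) ≤ 7`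
and non-zero centre, `X` is stably nondegenerate OR `dim MT(H¹X) = 7` with Weil-type degenerate CM part (§1).
[cite: MoonenZarhin1999LowDim, §2 and §3 Thm. (3.2)(2)] [cite: Gordon1999HodgeAVSurvey, Thm. 7.5 and Def. 7.6] -/
theorem isStablyNondegenerate_or_mtRank_eq_seven_of_not_isOfCMType_of_center_ne_bot (hX : IsSmoothProjective n X.X)
    (h0 : 0 < X.dim) (hcm : ¬ IsOfCMType X)
    (h7 : haveI := BettiUniverse.finite hX 1
      (BettiUniverse.hodge exists_isReal_hodgeModel_holds hX 1).mtRank ≤ 7)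
    (hz : haveI := BettiUniverse.finite hX 1
      (BettiUniverse.hodge exists_isReal_hodgeModel_holds hX 1).hodgeLie ⊓
        Subalgebra.toSubmodule (BettiUniverse.hodge exists_isReal_hodgeModel_holds hX 1).endAlg ≠ ⊥) :
    haveI := BettiUniverse.finite hX 1
    IsStablyNondegenerate X ∨ (BettiUniverse.hodge exists_isReal_hodgeModel_holds hX 1).mtRank = 7 := by
  rcases isStablyNondegenerate_or_cmPart_degenerate_of_finrank_derived_eq_three_of_mtRank_le_seven hX h0
      (finrank_derived_eq_three_of_mtRank_le_seven_of_center_ne_bot hX h0 hcm h7 hz) h7 with h | ⟨h, -⟩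
  · exact Or.inl h
  · exact Or.inr h

end Summit.HodgeConjecture.CorCM

end
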